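import Summits.Ventures.CertifiedManyBodySolver.Downfold.EmeryFermiOneBandRange
import Mathlib.MeasureTheory.Integral.Bochner.Basic
import HarnessLib

/-!
# THE ONE-NUMBER LAWS FOR ANY FERMI-SURFACE MEASURE: for every finite measure `μ` carried by an energy-`ε` contour of the σ three-band model,
# `∫ dμ/t_eff = (α·μ(1) + 8β·∫ s dμ)/fsT²` and `∫ w_d dμ/t_eff = 4t_pd²(Δ + ε)·[(Δ + ε)·μ(1) + 2(t_pp + t_pp′)·∫ (x + y) dμ]/(fsN1·fsT)` —
# the density of states and the Cu-PROJECTED density of states of every Fermi-surface weighting are TWO-MOMENT objects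

Venture CertifiedManyBodySolver, cell `pub/hubbard-downfold` (stage S1; INFLATION-RULES-3to1-B §B.76 (e)/(h)), seat hubbard-downfold-mod-4 (technique B, g31);
namespace `Summit.Ventures.CertifiedManyBodySolver.Downfold.Emery`. Sequel of `EmeryFermiOneBandRange` §6 (the finite quadrature law `sum_inv_scaleT`) and
`EmeryOrbitalWeightHarmonic` (`fsN1_mul_minorD`). The finite-family statements become statements for an ARBITRARY finite measure on the contour (arc length,
the one-band density-of-states measure `|dk|/|∇P₁|`, an ARPES intensity, a quadrature rule …) — no contour parametrisation is needed: linearity of the integral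
and the affine laws do all the work. Everything PROVED (0 sorry). WHAT THIS IS NOT: a statement about any material; `U = 0` one-body kinematics; the measure is an
input (this file does not construct the density-of-states measure).

* §1 POINTWISE: `1/t_eff(k) = (α + 8β·s(k))/fsT²` (§B.75) and **`w_d(k)/t_eff(k) = minorD(k)/fsT = 4t_pd²E(E + 2g(x + y))/(fsN1·fsT)`** on the contour
  (`dWeight_div_scaleT`, `dWeight_div_scaleT_of_contour`): the Cu-weighted inverse scale is AFFINE in `x + y` — the Möbius denominator of the weight IS the velocity
  denominator and cancels.
* §2 INTEGRATED: for a finite measure `μ` on `ℝ × ℝ` with `μ`-a.e. point on the contour, **`∫ (t_eff)⁻¹ dμ = (α·μ(univ) + 8β·∫ s dμ)/fsT²`** (`integral_inv_scaleT`)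
  and **`∫ w_d·(t_eff)⁻¹ dμ = 4t_pd²E·(E·μ(univ) + 2g·∫ (x + y) dμ)/(fsN1·fsT)`** (`integral_dWeight_div_scaleT`): the total and the Cu-projected «densities of states» of
  ANY Fermi-surface weighting are fixed by the mass and ONE first moment each (`s̄` resp. the mean of `x + y` — affinely related on the contour, `cA_add_harm`).

Sources: three-band model [HybertsenSchluterChristensen1989, Eq. (1)]; [AndersenEtAl1995, §6]; [folklore] algebra and Bochner-integral linearity.
-/

noncomputable section

namespace Summit.Ventures.CertifiedManyBodySolver.Downfold.Emery

open Real Set MeasureTheory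

/-! ## §1 Pointwise: the Cu-weighted inverse scale -/

/-- `w_d/t_eff = minorD/fsT` wherever the energy denominator is non-zero (the Möbius denominator of the weight IS the velocity denominator). [folklore] -/
theorem dWeight_div_scaleT {Δ tpd tpp c x y ε : ℝ} (hW : dcharCubic Δ tpd tpp c x y ε ≠ 0) :
    dWeight Δ tpd tpp c x y ε / scaleT Δ tpd tpp c x y ε = minorD Δ tpp c x y ε / fsT Δ tpd tpp c ε := by
  rw [dWeight_eq_div_dcharCubic]
  unfold scaleT
  rw [div_div_div_cancel_right₀ hW]

/-- ON THE CONTOUR **`w_d(k)/t_eff(k) = 4t_pd²(Δ + ε)((Δ + ε) + 2(t_pp + t_pp′)(x + y))/(fsN1·fsT)`** — AFFINE in `x + y` (`fsN1 ≠ 0`, energy denominator `≠ 0`). [folklore] -/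
theorem dWeight_div_scaleT_of_contour {Δ tpd tpp c x y ε : ℝ} (hP : charCubic Δ tpd tpp c x y ε = 0) (hN1 : fsN1 tpd tpp c ε ≠ 0)
    (hW : dcharCubic Δ tpd tpp c x y ε ≠ 0) :
    dWeight Δ tpd tpp c x y ε / scaleT Δ tpd tpp c x y ε =
      4 * tpd ^ 2 * (Δ + ε) * ((Δ + ε) + 2 * (tpp + c) * (x + y)) / (fsN1 tpd tpp c ε * fsT Δ tpd tpp c ε) := by
  rw [dWeight_div_scaleT hW]
  have h := fsN1_mul_minorD Δ tpd tpp c x y ε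
  rw [hP, mul_zero, add_zero] at h
  rw [← h, mul_div_mul_left _ _ hN1]

/-! ## §2 Integrated against any finite Fermi-surface measure -/

/-- **THE ONE-NUMBER LAW FOR ANY FERMI-SURFACE MEASURE**: `μ` finite, `μ`-a.e. point on the `ε`-contour, `s` integrable, `fsT ≠ 0` ⇒
`∫ (t_eff)⁻¹ dμ = (α·μ(univ) + 8β·∫ s dμ)/fsT²`. [folklore] -/
theorem integral_inv_scaleT {Δ tpd tpp c ε : ℝ} (μ : Measure (ℝ × ℝ)) [IsFiniteMeasure μ]
    (hP : ∀ᵐ p ∂μ, charCubic Δ tpd tpp c p.1 p.2 ε = 0) (hT : fsT Δ tpd tpp c ε ≠ 0) (hs : Integrable (fun p : ℝ × ℝ => tpHarm p.1 p.2) μ) :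
    ∫ p, (scaleT Δ tpd tpp c p.1 p.2 ε)⁻¹ ∂μ =
      (scaleAlpha Δ tpd tpp c ε * (μ Set.univ).toReal + 8 * scaleBeta Δ tpd tpp c ε * ∫ p, tpHarm p.1 p.2 ∂μ) / fsT Δ tpd tpp c ε ^ 2 := by
  have hae : (fun p : ℝ × ℝ => (scaleT Δ tpd tpp c p.1 p.2 ε)⁻¹) =ᵐ[μ]
      fun p => scaleAlpha Δ tpd tpp c ε / fsT Δ tpd tpp c ε ^ 2 + (8 * scaleBeta Δ tpd tpp c ε / fsT Δ tpd tpp c ε ^ 2) * tpHarm p.1 p.2 := by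
    filter_upwards [hP] with p hp
    rw [inv_scaleT_eq_harmonic hp hT]; ring
  rw [integral_congr_ae hae, integral_add (integrable_const _) (hs.const_mul _), integral_const, integral_const_mul, smul_eq_mul]
  unfold Measure.real
  ring

/-- **THE Cu-PROJECTED ONE-NUMBER LAW**: `μ` finite, `μ`-a.e. point on the `ε`-contour with non-zero energy denominator, `x + y` integrable, `fsN1 ≠ 0` ⇒
`∫ w_d·(t_eff)⁻¹ dμ = 4t_pd²(Δ + ε)·((Δ + ε)·μ(univ) + 2(t_pp + t_pp′)·∫ (x + y) dμ)/(fsN1·fsT)`. [folklore] -/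
theorem integral_dWeight_div_scaleT {Δ tpd tpp c ε : ℝ} (μ : Measure (ℝ × ℝ)) [IsFiniteMeasure μ]
    (hP : ∀ᵐ p ∂μ, charCubic Δ tpd tpp c p.1 p.2 ε = 0 ∧ dcharCubic Δ tpd tpp c p.1 p.2 ε ≠ 0) (hN1 : fsN1 tpd tpp c ε ≠ 0)
    (hs : Integrable (fun p : ℝ × ℝ => p.1 + p.2) μ) :
    ∫ p, dWeight Δ tpd tpp c p.1 p.2 ε / scaleT Δ tpd tpp c p.1 p.2 ε ∂μ =
      4 * tpd ^ 2 * (Δ + ε) * ((Δ + ε) * (μ Set.univ).toReal + 2 * (tpp + c) * ∫ p, (p.1 + p.2) ∂μ)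
        / (fsN1 tpd tpp c ε * fsT Δ tpd tpp c ε) := by
  set K : ℝ := 4 * tpd ^ 2 * (Δ + ε) / (fsN1 tpd tpp c ε * fsT Δ tpd tpp c ε) with hK
  have hae : (fun p : ℝ × ℝ => dWeight Δ tpd tpp c p.1 p.2 ε / scaleT Δ tpd tpp c p.1 p.2 ε) =ᵐ[μ]
      fun p => K * (Δ + ε) + (K * (2 * (tpp + c))) * (p.1 + p.2) := by
    filter_upwards [hP] with p hp
    rw [dWeight_div_scaleT_of_contour hp.1 hN1 hp.2, hK]; ring
  rw [integral_congr_ae hae, integral_add (integrable_const _) (hs.const_mul _), integral_const, integral_const_mul, smul_eq_mul, hK]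
  unfold Measure.real
  ring

end Summit.Ventures.CertifiedManyBodySolver.Downfold.Emery
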